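import Literature.AlgebraicGeometry.ModuliOfAbelianVarieties.SiegelUniversalFamilyChartCoverOfPiece
import Literature.AlgebraicGeometry.ModuliOfAbelianVarieties.SiegelPeriodLinearAvatarFamily
import Literature.AlgebraicGeometry.ModuliOfAbelianVarieties.SiegelAdmissibleChartCompatibility
import Literature.AlgebraicGeometry.AbelianSchemes.AbelianSchemeEndomorphismOfChartReadings
import Literature.AlgebraicGeometry.Motives.VarietiesGeometricallyIntegralProofs
import HarnessLib

/-!
# COV-6 FAMILY EDITION «ONE CALL PER PIECE, ALL LATTICE ENDOMORPHISMS AT ONCE»: a FAMILY of endomorphisms of the pulled-back universal Siegel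
# family over a disc-quotient piece read from a family `(A_b)_b` of integral lattice endomorphisms, ALL IN THE SAME ★ P-3 charts and markings
# ([BirkenhakeLange2004] §1.2 Prop. 1.2.1; [Shimura1963AnalyticFamilies] §2; [Lange2023AbelianVarietiesComplex] §3.4)

Topic `Literature/AlgebraicGeometry/ModuliOfAbelianVarieties`; namespace `Literature.AlgebraicGeometry.ModuliOfAbelianVarieties`.
THEOREMS ONLY (no definition, no named fact, no instance, no notation, no `sorry`); ★ P-3 `siegelUniversalFamilyUniformisation` enters as the
HYPOTHESIS `hP3` (D-0014).  Cell `hodgecm-mathlib` (D-0151), FLOOR 0, P6 «MOD» (crux hLiu418 = stmt-HodgeConjecture-24832, `--supports`), E6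
closer of `Cruxes/HLiu418/Lines/F0_P6a_PELWitnessE.lean`, socket Σ-AN `ReadsCReading` (E6 heir A-p06 (g33)).  WHY A FAMILY EDITION: the socket
`ReadsCReading` asks, at every complex point, for ONE admissible marking `m` through which EVERY `Y b` (`b ∈ 𝒪_F`) reads its matrix `Mρ a b`
(`∃ m …, ∀ b …`); ★ COV-6 `exists_isMonHom_of_piece_readings` (A-p04 (g24), p847522) is one call per matrix `A` and hides its charts and markings
behind an `∃` per call, so two calls cannot be compared.  This edition runs ★ COV-2 ONCE (charts `(U, σ, Φ, ex)`, (G), (ADM)) and then ★ COV-3∕4,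
★ COV-5, ★ E6-an′ for EVERY member `A b` of the family in those SAME charts — the proof of ★ COV-6 verbatim with `A ↦ A b`; the transport law
`htrans` asks the level element `M` to commute with EVERY `A b` (exactly the shape of ★ `AuxChartGS.Z_equivariant`, whose conclusion is `∀ b`).
HC_CM is proved only modulo the printed citations (2 remaining named inputs hLiu418 24832, h413 24833) until rung 0 closes; this file is generic
and changes no count.

THE MATHEMATICS ([Shimura1963AnalyticFamilies] §2; [BirkenhakeLange2004] Prop. 1.2.1): in the setting of ★ COV-2 (disc-quotient piece `T` with ball
datum `B`, slice `ψ : T ⟶ S_c` with holomorphic Siegel lift `Z`, pulled-back universal triple `P_T`, analytifications `φT`, `φA`), a family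
`(A_b)_{b ∈ ι} ⊆ M_{2g}(ℤ)` of lattice endomorphisms, each `ℂ`-linear for the complex structure of every `Z v`, which commute with the monodromy
SIMULTANEOUSLY (one `M ∈ Γ_δ(N)` per pair of lifts, commuting with all `A_b`), defines a family of endomorphisms `Y_b` of `P_T.A → T` whose analytic
representations in the COMMON relative exponential charts are the avatars `C_b` of the `A_b`.

* §1 **`exists_isMonHom_family_of_piece_readings`** — THE HEAD (hypotheses = ★ COV-6 with `A : ι → M_{2g}(ℤ)`; conclusion = ★ COV-6's with
  `C : ι → …`, `Y : ι → …` and the COV-2 data shared).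

## References
* [BirkenhakeLange2004] C. Birkenhake, H. Lange, *Complex Abelian Varieties*, 2nd ed. (2004), §1.2 Proposition 1.2.1.
* [Shimura1963AnalyticFamilies] G. Shimura, *On analytic families of polarized abelian varieties and automorphic functions*, Ann. Math. 78 (1963), §2.
* [Lange2023AbelianVarietiesComplex] H. Lange, *Abelian Varieties over the Complex Numbers* (2023), §3.4 Prop. 3.4.1 p. 186, Lemma 3.4.7 and
  Prop. 3.4.8 pp. 189–191.
* [Milne2005ShimuraVarieties] J. S. Milne, *Introduction to Shimura Varieties* (2005; rev. 2017), §6 Thm. 6.11 pp. 74–75.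
-/

set_option autoImplicit false

noncomputable section

open CategoryTheory CategoryTheory.Limits AlgebraicGeometry Matrix Topology
open scoped Manifold ContDiff Matrix.Norms.Elementwise
open Literature.AlgebraicGeometry.Motives (SchemeOver ComplexPoints AlgPoints specOver AbelianVariety CartierDivisor IsSmoothProjective)
open Literature.AlgebraicGeometry.AbelianSchemes (PolarizedAbelianSchemeWithLevel AbelianSchemeOver)
open Literature.AlgebraicGeometry.ShimuraVarieties (UnitaryBallUniformisationDatum negCone isOpen_negCone)
open Literature.Geometry.Kaehler (ComplexTorus)
open Literature.Geometry.Kaehler.ComplexTorus (cover)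
open Literature.Geometry.ComplexAnalytic (IsRelExpChartOn totalOver basePoint)
open Literature.NumberTheory.Transcendental (IsAnalytification)
open Literature.NumberTheory.Automorphic (siegelUpperHalfSpace)
open Literature.NumberTheory.Adeles (latticeOfGL)

namespace Literature.AlgebraicGeometry.ModuliOfAbelianVarieties

open SiegelModuli (jOfSiegel)

/-! ### §1 THE HEAD: one call per piece, every lattice endomorphism of the family at once -/

/-- **COV-6 FAMILY EDITION — A FAMILY OF ENDOMORPHISMS OF THE PULLED-BACK UNIVERSAL FAMILY OVER A DISC-QUOTIENT PIECE, READ FROM A FAMILY OF INTEGRAL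
LATTICE ENDOMORPHISMS COMMUTING WITH THE MONODROMY, ALL IN THE SAME CHARTS.**  Hypotheses: the ★ COV-6 list with the single matrix `A` replaced by a
family `A : ι → M_{2g}(ℤ)` — `hK b` = a `ℂ`-linear avatar of `A b` at every cone vector (first conjunct of `AuxChartGS.Mρ_kottwitz`), `htrans` = the
commuting transport law with `M` commuting with EVERY `A b` (`AuxChartGS.Z_equivariant` through ★ COV-5 §4).  Conclusion: the ★ COV-2 chart-cover
data `(U, σ, Φ, ex)` with all its clauses (sections, tautological periods, (C), (G), (ADM)) — SHARED by the whole family —, the avatar families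
`C b i t` and ENDOMORPHISMS `Y b : P_T.A.X ⟶ P_T.A.X`, `IsMonHom (Y b)`, each inducing its chart recipe
`(φA (ex i (t, C b i t z))).left = (φA (ex i (t, z))).left ≫ (Y b).left` in the common charts.  Proof = ★ COV-6's, with ★ COV-2 run once and
★ COV-3∕4 ∕ ★ COV-5 ∕ ★ E6-an′ run per `b`.
[cite: BirkenhakeLange2004, §1.2 Proposition 1.2.1] [cite: Shimura1963AnalyticFamilies, §2]
[cite: Lange2023AbelianVarietiesComplex, Prop. 3.4.1 p. 186 + Lemma 3.4.7 + Prop. 3.4.8 pp. 189–191 + Ex. 3.4.5 (7) p. 191 (universality); cf. Thm. 3.1.2 p. 163]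
[cite: Milne2005ShimuraVarieties, §6 Thm. 6.11 pp. 74–75] -/
theorem exists_isMonHom_family_of_piece_readings (hP3 : siegelUniversalFamilyUniformisation)
    (g N : ℕ) (δ : Fin g → ℕ) (hg : 0 < g) (hδ : IsPolarizationType δ) (hN : 3 ≤ N) (𝓜 : SiegelFineModuliScheme g N δ)
    -- a piece of `𝓜 ⊗ ℂ` with its uniformisation, satisfying the (U2+) clauses of ★ `siegelModuli_complexUniformisation`
    (c : (ZMod N)ˣ) (Sc : SchemeOver ℂ) (ιc : Sc ⟶ (Motives.baseChange ℚ ℂ).obj 𝓜.M)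
    (unif : Matrix (Fin g) (Fin g) ℂ → ComplexPoints Sc)
    (unif_cont : ContinuousOn unif (siegelUpperHalfSpace g)) (unif_open : IsOpenMap ((siegelUpperHalfSpace g).restrict unif))
    (unif_surj : Set.SurjOn unif (siegelUpperHalfSpace g) Set.univ)
    (unif_iff : ∀ Z ∈ siegelUpperHalfSpace g, ∀ Z' ∈ siegelUpperHalfSpace g,
      unif Z = unif Z' ↔ ∃ M ∈ siegelLevelGroup δ N, ∃ C : (Fin g → ℂ) ≃ₗ[ℂ] (Fin g → ℂ),
        ∀ v : Fin g ⊕ Fin g → ℝ, C (siegelPeriodMap δ Z v) = siegelPeriodMap δ Z' (intAct M v))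
    (unif_hol : ∀ (V : Sc.left.affineOpens) (f : Sc.left.presheaf.obj (Opposite.op (↑V : Sc.left.Opens))),
      DifferentiableOn ℂ (fun Z ↦ AlgPoints.evalOrZero (↑V : Sc.left.Opens) f (unif Z))
        (siegelUpperHalfSpace g ∩ unif ⁻¹' {P | P.pt ∈ (↑V : Sc.left.Opens)}))
    -- the (U3) junction for this piece: fibre identification (U3∃) and classification (U3-D3) at every `Z ∈ 𝔥_g`
    (junction : ∀ (u : finAdeleQˣ) (r : gspFinAdelic δ),
      (∀ v, Valued.v ((u : finAdeleQ) v) = 1) →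
      (u : finAdeleQ) - ((c : ZMod N).val : ℕ) ∈ levelIdeal N →
      r ∈ principalLevelSubgroup δ 1 →
      IsMultiplier (typeFormOver δ finAdeleQ) (r : GL (Fin g ⊕ Fin g) finAdeleQ) u →
      ((r : GL (Fin g ⊕ Fin g) finAdeleQ) : Matrix (Fin g ⊕ Fin g) (Fin g ⊕ Fin g) finAdeleQ) =
        Matrix.fromBlocks 1 0 0 ((u : finAdeleQ) • (1 : Matrix (Fin g) (Fin g) finAdeleQ)) →
      ∀ (Z : Matrix (Fin g) (Fin g) ℂ) (hZ : Z ∈ siegelUpperHalfSpace g),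
        haveI : IsLocallyNoetherian (specOver ℚ ℂ).left :=
          inferInstanceAs (IsLocallyNoetherian (Spec (CommRingCat.of ℂ)))
        (∃ (P' : PolarizedAbelianSchemeWithLevel g N δ (specOver ℚ ℂ).left)
            (G : P'.A.X.left ⟶ 𝓜.univ.A.X.left) (Ĝ : P'.D.hat.X.left ⟶ 𝓜.univ.D.hat.X.left),
            P'.IsBaseChangeVia 𝓜.univ
                ((AlgPoints.baseChangeEquiv (algebraMap ℚ ℂ) 𝓜.M).symm (AlgPoints.map ιc (unif Z))).left G Ĝ ∧
            IsAdmissibleAt hδ r Z hZ P') ∧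
        (∀ (P' : PolarizedAbelianSchemeWithLevel g N δ (specOver ℚ ℂ).left), IsAdmissibleAt hδ r Z hZ P' →
            AlgPoints.map ιc (unif Z)
              = AlgPoints.baseChangeEquiv (algebraMap ℚ ℂ) 𝓜.M (𝓜.classifyingMap (specOver ℚ ℂ) P')))
    -- the piece: a compact disc quotient `T` over the Siegel piece, and its slice morphism
    (T : SchemeOver ℂ) (B : UnitaryBallUniformisationDatum 1 T) {Jc : Matrix (Fin 2) (Fin 2) ℂ} (hB : B.Hℂ = Jc) (ψ : T ⟶ Sc)
    -- the holomorphic Siegel lift of `ψ` on the negative cone (★ E6-fac clause 1)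
    (Z : (Fin 2 → ℂ) → Matrix (Fin g) (Fin g) ℂ) (Z_hol : ∀ i j, DifferentiableOn ℂ (fun v => Z v i j) (negCone Jc))
    (Z_mem : ∀ v, v ∈ negCone Jc → Z v ∈ siegelUpperHalfSpace g)
    (hψ : ∀ v, v ∈ negCone Jc → AlgPoints.map ψ (B.unif v) = unif (Z v))
    -- analytifications of `T` (charts on `ℂ`) and of the total space of the pulled-back abelian scheme
    (MT : Type) [TopologicalSpace MT] [ChartedSpace (Fin 1 → ℂ) MT] [IsManifold 𝓘(ℂ, Fin 1 → ℂ) ω MT]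
    (φT : MT → ComplexPoints T) (hT : IsAnalytification (Fin 1 → ℂ) T 1 φT)
    (MA : Type) [TopologicalSpace MA] [ChartedSpace (Fin (1 + g) → ℂ) MA] [IsManifold 𝓘(ℂ, Fin (1 + g) → ℂ) ω MA]
    (φA : MA → ComplexPoints (totalOver T
      (𝓜.univ.baseChange (ψ.left ≫ ιc.left ≫ pullback.fst 𝓜.M.hom (Spec.map (CommRingCat.ofHom (algebraMap ℚ ℂ))))).A))
    (hA : IsAnalytification (Fin (1 + g) → ℂ) (totalOver T
      (𝓜.univ.baseChange (ψ.left ≫ ιc.left ≫ pullback.fst 𝓜.M.hom (Spec.map (CommRingCat.ofHom (algebraMap ℚ ℂ))))).A) (1 + g) φA)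
    -- the total space of the pulled-back abelian scheme is smooth projective (★ E6-Π in the closer)
    (hTot : IsSmoothProjective (1 + g) (totalOver T
      (𝓜.univ.baseChange (ψ.left ≫ ιc.left ≫ pullback.fst 𝓜.M.hom (Spec.map (CommRingCat.ofHom (algebraMap ℚ ℂ))))).A))
    -- a principal representative `(u, r)` of the piece index `c` (the five (U3) premisses)
    (u : finAdeleQˣ) (r : gspFinAdelic δ) (hu : ∀ v, Valued.v ((u : finAdeleQ) v) = 1)
    (huc : (u : finAdeleQ) - ((c : ZMod N).val : ℕ) ∈ levelIdeal N) (hr : r ∈ principalLevelSubgroup δ 1)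
    (hmult : IsMultiplier (typeFormOver δ finAdeleQ) (r : GL (Fin g ⊕ Fin g) finAdeleQ) u)
    (hrmat : ((r : GL (Fin g ⊕ Fin g) finAdeleQ) : Matrix (Fin g ⊕ Fin g) (Fin g ⊕ Fin g) finAdeleQ) =
      Matrix.fromBlocks 1 0 0 ((u : finAdeleQ) • (1 : Matrix (Fin g) (Fin g) finAdeleQ)))
    -- the integral lattice endomorphism, `ℂ`-linear at every cone vector, commuting with the monodromy
    {ι : Type} (A : ι → Matrix (Fin g ⊕ Fin g) (Fin g ⊕ Fin g) ℤ)
    (hK : ∀ b, ∀ v ∈ negCone Jc, ∃ Cv : (Fin g → ℂ) →ₗ[ℂ] (Fin g → ℂ),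
      ∀ w : Fin g ⊕ Fin g → ℝ, Cv (siegelPeriodMap δ (Z v) w) = siegelPeriodMap δ (Z v) (((A b).map (Int.cast : ℤ → ℝ)) *ᵥ w))
    (htrans : ∀ v ∈ negCone Jc, ∀ v' ∈ negCone Jc, B.unif v = B.unif v' →
      ∃ M ∈ siegelLevelGroup δ N, ∃ L : (Fin g → ℂ) ≃ₗ[ℂ] (Fin g → ℂ),
        (∀ w : Fin g ⊕ Fin g → ℝ, L (siegelPeriodMap δ (Z v) w) = siegelPeriodMap δ (Z v') (intAct M w)) ∧
        ∀ b, (M : Matrix (Fin g ⊕ Fin g) (Fin g ⊕ Fin g) ℤ) * A b = A b * (M : Matrix (Fin g ⊕ Fin g) (Fin g ⊕ Fin g) ℤ)) :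
    letI P := 𝓜.univ.baseChange (ψ.left ≫ ιc.left ≫ pullback.fst 𝓜.M.hom (Spec.map (CommRingCat.ofHom (algebraMap ℚ ℂ))))
    ∃ (U : MT → Set MT) (σ : MT → MT → (Fin 2 → ℂ))
      (Φ : MT → MT → ((Fin g ⊕ Fin g → ℝ) ≃L[ℝ] (Fin g → ℂ))) (ex : MT → MT × (Fin g → ℂ) → MA)
      (C : ι → MT → MT → ((Fin g → ℂ) →L[ℂ] (Fin g → ℂ))) (Y : ι → (P.A.X ⟶ P.A.X)),
      -- the section domains cover `MT`
      (∀ i, IsOpen (U i)) ∧ (∀ i, i ∈ U i) ∧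
      -- the sections: cone-valued, lifting `φT` through `unif_B`, complex-differentiable on `U i`
      (∀ i, ∀ t ∈ U i, σ i t ∈ negCone Jc ∧ B.unif (σ i t) = φT t) ∧
      (∀ i, ∀ t ∈ U i, MDifferentiableAt 𝓘(ℂ, Fin 1 → ℂ) 𝓘(ℂ, Fin 2 → ℂ) (σ i) t) ∧
      -- the period family is the tautological one along the lift `Z ∘ σ i`
      (∀ i, ∀ t ∈ U i, ∀ v : Fin g ⊕ Fin g → ℝ, Φ i t v = siegelPeriodMap δ (Z (σ i t)) v) ∧
      -- (C) the charts
      (∀ i, IsRelExpChartOn (Fin 1 → ℂ) (Fin (1 + g) → ℂ) (basePoint hT P.A φA) (U i) (Φ i) (ex i)) ∧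
      -- (G) the fibre maps are additive analytifications of the fibres, read in the total space
      (∀ i, ∀ t ∈ U i, ∃ φt : ComplexTorus (Φ i t) → (P.A.fibre (φT t).left).toAbelianVariety.Points ℂ,
        IsAnalytification (Fin g → ℂ) (P.A.fibre (φT t).left).toAbelianVariety.X g φt ∧
        (∀ x y, φt (x + y) = φt x * φt y) ∧
        ∀ z : Fin g → ℂ, (φA (ex i (t, z))).left = P.A.fibrePointToLeft (φT t).left (φt (cover (Φ i t) z))) ∧
      -- (ADM) the fibre maps ARE admissible markings by `[J(Z (σ i t)), r]`, for every principal representative `r` of `c`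
      (∀ i, ∀ (u : finAdeleQˣ) (r : gspFinAdelic δ),
        (∀ v, Valued.v ((u : finAdeleQ) v) = 1) →
        (u : finAdeleQ) - ((c : ZMod N).val : ℕ) ∈ levelIdeal N →
        r ∈ principalLevelSubgroup δ 1 →
        IsMultiplier (typeFormOver δ finAdeleQ) (r : GL (Fin g ⊕ Fin g) finAdeleQ) u →
        ((r : GL (Fin g ⊕ Fin g) finAdeleQ) : Matrix (Fin g ⊕ Fin g) (Fin g ⊕ Fin g) finAdeleQ) =
          Matrix.fromBlocks 1 0 0 ((u : finAdeleQ) • (1 : Matrix (Fin g) (Fin g) finAdeleQ)) →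
        ∀ (t : MT) (ht : t ∈ U i),
          ∃ (hZt : Z (σ i t) ∈ siegelUpperHalfSpace g)
            (m : SiegelAdelicMarking ⟨jOfSiegel δ (Z (σ i t)), SiegelComplexRecordSystem.jOfSiegel_mem_C0pm hδ.1 hZt⟩ r
              (P.A.fibre (φT t).left).toAbelianVariety)
            (Θ : CartierDivisor (P.A.fibre (φT t).left).toAbelianVariety.X.left)
            (Λ : P.level.SymplecticLift (φT t).left Θ δ),
            Θ.IsAmple ∧ P.A.IsLambdaOfAt (φT t).left P.D P.pol.lam Θ ∧
            (∀ ⦃M : ℕ⦄, N ∣ M → M ≠ 0 → ∀ (x : Fin g ⊕ Fin g → ZMod M) (v : Fin g ⊕ Fin g → ℚ),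
              AdelicCongr ((r⁻¹ : gspFinAdelic δ) : GL (Fin g ⊕ Fin g) finAdeleQ) 1 v (fun i => ((x i).val : ℚ) / M) →
                ((Λ.lift M (Multiplicative.ofAdd x)) : (P.A.fibre (φT t).left).toAbelianVariety.Points ℂ) = m.r v) ∧
            m.γ = 1 ∧ (∀ v : Fin g ⊕ Fin g → ℝ, m.Ψ v = siegelPeriodMap δ (Z (σ i t)) v) ∧
            ∀ z : Fin g → ℂ, P.A.fibrePointToLeft (φT t).left (m.toFun (cover m.Ψ z)) = (φA (ex i (t, z))).left) ∧
      -- the avatar families of the `A b` along the sections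
      (∀ b i, ∀ t ∈ U i, ∀ w : Fin g ⊕ Fin g → ℝ,
        C b i t (siegelPeriodMap δ (Z (σ i t)) w) = siegelPeriodMap δ (Z (σ i t)) (((A b).map (Int.cast : ℤ → ℝ)) *ᵥ w)) ∧
      -- THE ENDOMORPHISMS and their chart recipes, all in the SAME charts
      (∀ b, IsMonHom (Y b)) ∧
      ∀ b i, ∀ t ∈ U i, ∀ z : Fin g → ℂ, (φA (ex i (t, C b i t z))).left = (φA (ex i (t, z))).left ≫ (Y b).left := by
  let P := 𝓜.univ.baseChange (ψ.left ≫ ιc.left ≫ pullback.fst 𝓜.M.hom (Spec.map (CommRingCat.ofHom (algebraMap ℚ ℂ))))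
  -- instances on the disc quotient `T`
  have hX : IsSmoothProjective 1 T := B.isSmoothProjective
  haveI : SmoothOfRelativeDimension 1 T.hom := hX.smoothOfRelativeDimension
  haveI : IsProper T.hom := IsSmoothProjective.isProper_holds hX
  haveI : IsSeparated T.hom := inferInstance
  haveI : LocallyOfFiniteType T.hom := inferInstance
  haveI : IsIntegral T.left := IsSmoothProjective.isIntegral_holds hX
  haveI : IsReduced T.left := inferInstance
  -- ★ COV-2: charts, sections, (G), (ADM) on the section-domain cover indexed by the points of `MT`
  let P := 𝓜.univ.baseChange (ψ.left ≫ ιc.left ≫ pullback.fst 𝓜.M.hom (Spec.map (CommRingCat.ofHom (algebraMap ℚ ℂ))))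
  -- instances on the disc quotient `T`
  have hX : IsSmoothProjective 1 T := B.isSmoothProjective
  haveI : SmoothOfRelativeDimension 1 T.hom := hX.smoothOfRelativeDimension
  haveI : IsProper T.hom := IsSmoothProjective.isProper_holds hX
  haveI : IsSeparated T.hom := inferInstance
  haveI : LocallyOfFiniteType T.hom := inferInstance
  haveI : IsIntegral T.left := IsSmoothProjective.isIntegral_holds hX
  haveI : IsReduced T.left := inferInstance
  -- ★ COV-2: charts, sections, (G), (ADM) on the section-domain cover indexed by the points of `MT` — ONCE, for all `b`
  obtain ⟨U, σ, Φ, ex, hUo, hiU, hσ, hσd, hΦ, hex, hG, hADM⟩ :=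
    exists_univFamilyChartCover_of_piece hP3 g N δ hg hδ hN 𝓜 c Sc ιc unif unif_cont unif_open unif_surj unif_iff unif_hol
      junction T B hB ψ Z Z_hol Z_mem hψ MT φT hT MA φA hA
  -- ★ COV-3∕4: the avatar families along the sections, per `b`
  have hfam : ∀ (b : ι) (i : MT), ∃ Cfam : MT → ((Fin g → ℂ) →L[ℂ] (Fin g → ℂ)),
      MDifferentiableOn 𝓘(ℂ, Fin 1 → ℂ) 𝓘(ℂ, (Fin g → ℂ) →L[ℂ] (Fin g → ℂ)) Cfam (U i) ∧
      (∀ t ∈ U i, ∀ w : Fin g ⊕ Fin g → ℝ,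
        Cfam t (siegelPeriodMap δ (Z (σ i t)) w) = siegelPeriodMap δ (Z (σ i t)) (((A b).map (Int.cast : ℤ → ℝ)) *ᵥ w)) ∧
      ∀ t ∈ U i, ∀ n : Fin g ⊕ Fin g → ℤ, Cfam t (Φ i t (fun k => (n k : ℝ))) = Φ i t (fun k => ((A b *ᵥ n) k : ℝ)) := fun b i =>
    exists_clm_family_along_lift hδ.1 (isOpen_negCone Jc) Z_hol (A b) (hK b) (σ i) (fun t ht => (hσ i t ht).1) (hσd i) (Φ i) (hΦ i)
  choose Cf hCfd hCf hCfN using hfam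
  -- ★ COV-5: compatibility on common fibres, per `b` (the transport `M` commutes with every `A b`)
  have hcompat : ∀ b i j, ∀ t ∈ U i ∩ U j, ∀ z z' : Fin g → ℂ,
      ex i (t, z) = ex j (t, z') → ex i (t, Cf b i t z) = ex j (t, Cf b j t z') := by
    intro b i j t ht z z' h
    have hti : t ∈ U i := ht.1
    have htj : t ∈ U j := ht.2
    have hunif : B.unif (σ i t) = B.unif (σ j t) := (hσ i t hti).2.trans (hσ j t htj).2.symm
    obtain ⟨M, hM, L, hrel, hMA⟩ := htrans (σ i t) (hσ i t hti).1 (σ j t) (hσ j t htj).1 hunif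
    obtain ⟨hZt, m, Θ, Λ, -, hΘl, hΛ, hγ, hΨ, hread⟩ := hADM i u r hu huc hr hmult hrmat t hti
    obtain ⟨hZt', m', Θ', Λ', -, hΘl', hΛ', hγ', hΨ', hread'⟩ := hADM j u r hu huc hr hmult hrmat t htj
    exact SiegelAdelicMarking.chart_apply_eq_of_chart_eq_of_periodMap_rel_of_injective hg hδ hN hr hZt hZt' m Λ hΘl hΛ
      m' Λ' hΘl' hΛ' hM L hrel hγ hγ' hΨ hΨ' (A b) (hMA b) (Cf b i t) (Cf b j t) (hCf b i t hti) (hCf b j t htj) φA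
      hA.isHomeomorph.injective (fun z => ex i (t, z)) (fun z => ex j (t, z)) hread hread' h
  -- ★ E6-an′: glue + GAGA + rigidity, per `b`, in the SAME charts
  have hY : ∀ b, ∃ Y : P.A.X ⟶ P.A.X, IsMonHom Y ∧
      ∀ i, ∀ t ∈ U i, ∀ z : Fin g → ℂ, (φA (ex i (t, Cf b i t z))).left = (φA (ex i (t, z))).left ≫ Y.left := fun b =>
    AbelianSchemeOver.exists_isMonHom_of_chartReadings_of_additive P.A hTot hT hA hex
      (fun t => ⟨t, hiU t⟩) (fun i t ht => by
        obtain ⟨φt, -, hadd, hrd⟩ := hG i t ht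
        exact ⟨φt, hadd, hrd⟩)
      (Cf b) (hCfd b) (fun _ _ n => A b *ᵥ n) (hCfN b) (hcompat b)
  choose Y hYm hrec using hY
  exact ⟨U, σ, Φ, ex, Cf, Y, hUo, hiU, hσ, hσd, hΦ, hex, hG, hADM, hCf, hYm, hrec⟩

end Literature.AlgebraicGeometry.ModuliOfAbelianVarieties

end
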